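import Literature.Computability.AlgebraicComplexity.KoszulYoungCertificate
import Summits.MatrixMultiplication.MatrixMultiplication.Theorems.SoloInformedTriangularThreeBini
import HarnessLib

/-!
# `8 ≤ bR(T(U₃)) ≤ 9` over every field: the Koszul–Young half of the window

`T(U₃) = ⟨3,3,3⟩_{U₃,U₃}` ("upper triangular times upper triangular" of order `3`, the structure
tensor of the algebra `T₃(K)` of upper triangular `3 × 3` matrices, padded by zero slices to the format
`(3²)³`) is the integer tensor `triThreeInt` of `SoloInformedTriangularThreeBini`, where
`bR(T(U₃)) ≤ 9 < 10 = R(T(U₃))` is certified (Bini's five products live inside `U₃`).  Here the LOWER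
half of the window is kernel-checked: **`8 ≤ bR(T(U₃))` over every field**, by an integer
Koszul–Young (`p = 1`) flattening certificate [LandsbergOttaviani2015, Thm. 2.1] checked by
`decide +kernel` through the tree's `KYCert` machinery: along the `3 × 9` integer matrix `triThreeKyM`
on the `x`-leg (the leg `(i,j)` of `x_{ij}`, wedged), the `27 × 27` flattening
`Λ¹K³ ⊗ (K⁹)* → Λ²K³ ⊗ K⁹` of `T(U₃)` has `15` rows certified independent with UNIT pivots, and
`15 > 2 · 7` forces `bR ≥ 8` (`rank ≤ C(2,1) · bR`).  Over `ℂ` the number `8` is the bound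
`bR(T₃) ≥ ⌈3(3·3+1)/4⌉` of [BurgisserClausenShokrollahi1997, Cor. (19.14)]; the certificate makes it
a theorem of the tree in every characteristic and pins the window

  `bR(T(U₃)) ∈ {8, 9}`   (`algBorderRank_triThree_mem`).

## What is NOT decided, and why the obvious next tool does not decide it (recorded, not formalised)
Which of `8, 9` holds is open here.  Numerically (CP-ALS, 16 seeds) rank-`8` approximations of
`T(U₃)` stall at relative residual `√(1/10)` while rank `9` shows the border signature, suggesting
`bR(T₃(ℂ)) = 9`.  The border substitution method [LandsbergGCT2017, Prop. 5.4.1.3, §5.4.3] over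
Koszul–Young base cases does NOT separate `8` from `9`: the stabiliser `(p,q,r) ∈ (U₃^×)³` acts on the
`x`- and `y`-legs by `Λ ↦ pᵀΛq⁻ᵀ` (Borel-fixed lines = the diagonal slices `x_{kk}`, `y_{kk}`) and on the
`z`-leg by `Ω ↦ p⁻¹Ωr` (unique fixed line `z₁₃`), and the exact game value
`max(KY, 1 + min_{fixed ℓ} value(T/ℓ))`, computed to depth `6` with exact Koszul–Young ranks, is `8`
(`KY(T/x_{kk}) ∈ {6,6,7}`, `KY(T/z₁₃) = 6`).

## Final statements use only tree definitions
`algBorderRank`, `partialMatMulTensor`, `intTriCheckUnit`, `KYCert.kyEntry`, `triThreeInt`.  The three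
`def`s below are plain certificate data (lists of integers).
-/

namespace Summit.MatrixMultiplication.MatrixMultiplication.Theorems

open Literature.Computability.AlgebraicComplexity Literature.LinearAlgebra.Matrix

/-! ## The certificate (found by exact elimination outside Lean; only its check is in the kernel) -/

/-- The `3 × 9` integer restriction matrix on the `x`-leg (columns = flat positions `3i+j`; supported on
the six upper positions). [folklore] -/
def triThreeKyM : List (List ℤ) :=
  [[-1, 0, 0, 0, 0, -1, 0, 0, 0], [0, 0, 0, 0, 1, 0, 0, 0, 0], [0, 1, 0, 0, 0, 0, 0, 0, -1]]

/-- Fifteen sparse integer row combinations of the `27 × 27` code matrix. [folklore] -/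
def triThreeKyRows : List (List (ℕ × ℤ)) :=
  [[(0, 1)], [(1, 1)], [(2, 1)], [(4, 1)], [(9, 1)], [(14, 1)], [(17, 1)], [(19, 1)], [(20, 1)],
   [(22, 1)], [(23, 1)], [(26, 1)], [(11, 1)], [(4, -1), (10, 1)], [(5, 1), (11, -1), (26, 1)]]

/-- Their pivot columns (lower-triangular with diagonal entries `±1`). [folklore] -/
def triThreeKyPiv : List ℕ :=
  [9, 10, 11, 4, 18, 26, 8, 13, 14, 22, 23, 17, 5, 19, 20]

/-- **The check.** The integer `p = 1` Koszul–Young flattening of the rotated tensor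
`(j,l,i) ↦ triThreeInt i j l` (the `x`-leg first, wedged along `triThreeKyM`) has `15` rows certified
independent with unit pivots. [cite: LandsbergOttaviani2015, Thm. 2.1] -/
theorem triThree_kyCheckUnit :
    intTriCheckUnit 15 (KYCert.kyEntry 9 9 9 triThreeKyM fun j l i => triThreeInt i j l)
      triThreeKyRows triThreeKyPiv = true := by
  decide +kernel

/-! ## `8 ≤ bR(T(U₃))` and the window `{8, 9}` -/

/-- **`8 ≤ bR(T(U₃))` over every field** (explicit integer tensor `triThreeInt`): Koszul–Young,
`15 > 2 · (8 - 1)`. [cite: LandsbergOttaviani2015, Thm. 2.1][cite: BurgisserClausenShokrollahi1997, Cor. 19.14] -/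
theorem eight_le_algBorderRank_triThree (K : Type*) [Field K] :
    8 ≤ algBorderRank (fun i j l => (triThreeInt i j l : K)) := by
  have h8 : 8 ≤ algBorderRank (fun j l i => (triThreeInt i j l : K)) :=
    KYCert.le_algBorderRank_of_kyCheckUnit K triThreeKyM (fun j l i => triThreeInt i j l)
      triThree_kyCheckUnit (by norm_num)
  exact KYCert.le_algBorderRank_of_rotate₁ K triThreeInt h8

/-- **The window `bR(T(U₃)) ∈ {8, 9}` over every field** (with `algBorderRank_triThree_le_nine` of
`SoloInformedTriangularThreeBini`). [cite: BurgisserClausenShokrollahi1997, Cor. 19.14 and §15.2] -/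
theorem algBorderRank_triThree_mem (K : Type*) [Field K] :
    algBorderRank (fun i j l => (triThreeInt i j l : K)) = 8 ∨
      algBorderRank (fun i j l => (triThreeInt i j l : K)) = 9 := by
  have h8 := eight_le_algBorderRank_triThree K
  have h9 := algBorderRank_triThree_le_nine K
  omega

/-- **`8 ≤ bR(⟨3,3,3⟩_{U₃,U₃})` over every field**, padded partial-matrix-multiplication form.
[cite: LandsbergOttaviani2015, Thm. 2.1][cite: BurgisserClausenShokrollahi1997, Cor. 19.14] -/
theorem eight_le_algBorderRank_partialMatMul_upper_three (K : Type*) [Field K] :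
    8 ≤ algBorderRank (partialMatMulTensor K 3 3 3 (Finset.univ.filter fun p : Fin 3 × Fin 3 => p.1 ≤ p.2)
        (Finset.univ.filter fun p : Fin 3 × Fin 3 => p.1 ≤ p.2)) := by
  rw [partialMatMulTensor_upper_three_eq]
  have h := algBorderRank_reindex (ι' := Fin 3 × Fin 3) (κ' := Fin 3 × Fin 3) (μ' := Fin 3 × Fin 3)
    finProdFinEquiv finProdFinEquiv finProdFinEquiv (fun i j l => (triThreeInt i j l : K))
  rw [h]
  exact eight_le_algBorderRank_triThree K

/-- **`bR(⟨3,3,3⟩_{U₃,U₃}) ∈ {8, 9}` over every field**, padded form.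
[cite: BurgisserClausenShokrollahi1997, Cor. 19.14 and §15.2] -/
theorem algBorderRank_partialMatMul_upper_three_mem (K : Type*) [Field K] :
    algBorderRank (partialMatMulTensor K 3 3 3 (Finset.univ.filter fun p : Fin 3 × Fin 3 => p.1 ≤ p.2)
        (Finset.univ.filter fun p : Fin 3 × Fin 3 => p.1 ≤ p.2)) = 8 ∨
      algBorderRank (partialMatMulTensor K 3 3 3 (Finset.univ.filter fun p : Fin 3 × Fin 3 => p.1 ≤ p.2)
        (Finset.univ.filter fun p : Fin 3 × Fin 3 => p.1 ≤ p.2)) = 9 := by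
  have h8 := eight_le_algBorderRank_partialMatMul_upper_three K
  have h9 := algBorderRank_partialMatMul_upper_three_le_nine K
  omega

end Summit.MatrixMultiplication.MatrixMultiplication.Theorems
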